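import Summits.CriticalPhenomena.CardyFormulaZ2.Theorems.CardyIKTransportIKLinearTransportDXCore1

/-!
# Pinned diagram exchange on cylinders — core part 2 (generic, Mathlib-only)

Helper file toward the stub `stub_DiagramExchange` of the line `pinned-diagram-exchange` (crux
stmt-CriticalPhenomena-5076): the pinned Yang–Baxter identity `DiagramExchangeAt L` on all cylinders `ℤ/L`, `L ≥ 3`,
by a train argument in the coloured partition category (see the final file for the overview).

PART 2: abstract graph lemmas (separator, substitution, transport along an injection) and necklaces with their
window coordinates.
-/

namespace Summit.CriticalPhenomena.CardyFormulaZ2.Theorems.IKLinearTransport.PinnedDiagramExchange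

namespace DX

open SimpleGraph

/-! ## §3 Abstract graph lemmas: separator, substitution, transport along an injection -/

section Graph

variable {V : Type*}

/-- The reachability relation of `W` read on the vertex set `S`, as a graph. [folklore] -/
def linkG (W : SimpleGraph V) (S : Set V) : SimpleGraph V :=
  fromRel fun s s' => s ∈ S ∧ s' ∈ S ∧ W.Reachable s s'

/-- SEPARATOR LEMMA. If `W` lives on `S ∪ {m}` and `R` avoids `m`, reachability in `W ⊔ R` between
vertices other than `m` only depends on `W` through its reachability relation on `S`. [folklore] -/
theorem sep_core (W R : SimpleGraph V) (S : Set V) (m : V)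
    (hW : ∀ u v, W.Adj u v → (u ∈ S ∨ u = m) ∧ (v ∈ S ∨ v = m)) (hR : ∀ v, ¬ R.Adj m v)
    {x y : V} (hx : x ≠ m) (hy : y ≠ m) :
    (W ⊔ R).Reachable x y ↔ (linkG W S ⊔ R).Reachable x y := by
  constructor
  · rintro ⟨p⟩
    suffices key : ∀ u (q : (W ⊔ R).Walk u y), (u ≠ m → (linkG W S ⊔ R).Reachable u y) ∧
        (∀ s, W.Adj s u → u = m → (linkG W S ⊔ R).Reachable s y) from (key x p).1 hx
    intro u q
    clear p hx
    induction q with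
    | nil => exact ⟨fun _ => Reachable.refl _, fun s _ hu => absurd hu hy⟩
    | @cons u v w huv q ih =>
      have hWuv : v = m → W.Adj u v := by
        rintro rfl
        rcases (sup_adj _ _ _ _).1 huv with h | h
        · exact h
        · exact absurd h.symm (hR u)
      refine ⟨fun hu => ?_, fun s hsu hum => ?_⟩
      · by_cases hv : v = m
        · exact (ih hy).2 u (hWuv hv) hv
        · refine Reachable.trans ?_ ((ih hy).1 hv)
          rcases (sup_adj _ _ _ _).1 huv with h | h
          · exact Adj.reachable ((sup_adj _ _ _ _).2 (Or.inl
              ⟨h.ne, Or.inl ⟨(hW u v h).1.resolve_right hu, (hW u v h).2.resolve_right hv, h.reachable⟩⟩))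
          · exact Adj.reachable ((sup_adj _ _ _ _).2 (Or.inr h))
      · subst hum
        have hWmv : W.Adj u v := by
          rcases (sup_adj _ _ _ _).1 huv with h | h
          · exact h
          · exact absurd h (hR v)
        have hv : v ≠ u := hWmv.ne.symm
        have hs : s ∈ S := (hW s u hsu).1.resolve_right hsu.ne
        have hvS : v ∈ S := (hW u v hWmv).2.resolve_right hv
        refine Reachable.trans ?_ ((ih hy).1 hv)
        by_cases hsv : s = v
        · subst hsv; exact Reachable.refl _
        · exact Adj.reachable ((sup_adj _ _ _ _).2 (Or.inl
            ⟨hsv, Or.inl ⟨hs, hvS, hsu.reachable.trans hWmv.reachable⟩⟩))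
  · rintro ⟨p⟩
    clear hx
    induction p with
    | nil => exact Reachable.refl _
    | @cons u v w huv q ih =>
      refine Reachable.trans ?_ (ih hy)
      rcases (sup_adj _ _ _ _).1 huv with ⟨-, h | h⟩ | h
      · exact h.2.2.mono le_sup_left
      · exact (h.2.2.mono le_sup_left).symm
      · exact Adj.reachable ((sup_adj _ _ _ _).2 (Or.inr h))

/-- The diagram read through a signature `σ` (the window replaced by its partition graph). [folklore] -/
def Fdiag {B Sg : Type*} (S : Set V) (R : SimpleGraph V) (emb : B → V) (P : Sg → V → V → Prop)
    (σ : Sg) : Set (B × B) :=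
  {pq | ((fromRel fun s s' => s ∈ S ∧ s' ∈ S ∧ P σ s s') ⊔ R).Reachable (emb pq.1) (emb pq.2)}

/-- A window's diagram-resolved summand only depends on its signature. [folklore] -/
theorem summand_eq_of_sig {B C Sg : Type*} (S : Set V) (m : V) (R : SimpleGraph V)
    (hR : ∀ v, ¬ R.Adj m v) (emb : B → V) (hemb : ∀ b, emb b ≠ m) (P : Sg → V → V → Prop)
    (W : C → SimpleGraph V) (w : C → ℝ) (sg : C → Sg)
    (hW : ∀ c u v, (W c).Adj u v → (u ∈ S ∨ u = m) ∧ (v ∈ S ∨ v = m))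
    (hP : ∀ c, w c ≠ 0 → ∀ s ∈ S, ∀ s' ∈ S, ((W c).Reachable s s' ↔ P (sg c) s s'))
    (Δ : Set (B × B)) (c : C) :
    (if {pq : B × B | (W c ⊔ R).Reachable (emb pq.1) (emb pq.2)} = Δ then w c else 0) =
      (if Fdiag S R emb P (sg c) = Δ then (1 : ℝ) else 0) * w c := by
  classical
  by_cases hc : w c = 0
  · simp [hc]
  · have hG : linkG (W c) S = fromRel fun s s' => s ∈ S ∧ s' ∈ S ∧ P (sg c) s s' := by
      ext u v
      simp only [linkG, fromRel_adj]
      constructor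
      · rintro ⟨hne, ⟨hu, hv, h⟩ | ⟨hv, hu, h⟩⟩
        · exact ⟨hne, Or.inl ⟨hu, hv, (hP c hc u hu v hv).1 h⟩⟩
        · exact ⟨hne, Or.inr ⟨hv, hu, (hP c hc v hv u hu).1 h⟩⟩
      · rintro ⟨hne, ⟨hu, hv, h⟩ | ⟨hv, hu, h⟩⟩
        · exact ⟨hne, Or.inl ⟨hu, hv, (hP c hc u hu v hv).2 h⟩⟩
        · exact ⟨hne, Or.inr ⟨hv, hu, (hP c hc v hv u hu).2 h⟩⟩
    have hD : {pq : B × B | (W c ⊔ R).Reachable (emb pq.1) (emb pq.2)} = Fdiag S R emb P (sg c) := by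
      ext pq
      simp only [Set.mem_setOf_eq, Fdiag]
      rw [sep_core (W c) R S m (hW c) hR (hemb pq.1) (hemb pq.2), hG]
    rw [hD]
    split_ifs <;> simp

/-- Regrouping a sum by the values of a signature. [folklore] -/
theorem regroup_sum {C Sg : Type*} [Fintype C] [DecidableEq Sg] (T : Finset Sg) (g : Sg → ℝ)
    (w : C → ℝ) (sg : C → Sg) (hT : ∀ c, sg c ∈ T) :
    ∑ c, g (sg c) * w c = ∑ σ ∈ T, g σ * ∑ c, (if sg c = σ then w c else 0) := by
  have : ∀ c, g (sg c) * w c = ∑ σ ∈ T, g σ * (if sg c = σ then w c else 0) := by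
    intro c
    rw [Finset.sum_eq_single (sg c)]
    · simp
    · intro σ _ hσ; simp [Ne.symm hσ]
    · intro h; exact absurd (hT c) h
  simp_rw [this]
  rw [Finset.sum_comm]
  simp_rw [Finset.mul_sum]

/-- SUBSTITUTION LEMMA. Two families of window graphs with the same partition-level transfer (up to
the scalars `κ, κ'`) give the same diagram-resolved sums against any common rest `R`. [folklore] -/
theorem subst_sum {B Cin Cin' Sg : Type*} [Fintype Cin] [Fintype Cin'] [DecidableEq Sg]
    (S : Set V) (m : V) (R : SimpleGraph V) (hR : ∀ v, ¬ R.Adj m v)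
    (emb : B → V) (hemb : ∀ b, emb b ≠ m) (P : Sg → V → V → Prop)
    (W : Cin → SimpleGraph V) (w : Cin → ℝ) (sg : Cin → Sg)
    (hW : ∀ c u v, (W c).Adj u v → (u ∈ S ∨ u = m) ∧ (v ∈ S ∨ v = m))
    (hP : ∀ c, w c ≠ 0 → ∀ s ∈ S, ∀ s' ∈ S, ((W c).Reachable s s' ↔ P (sg c) s s'))
    (W' : Cin' → SimpleGraph V) (w' : Cin' → ℝ) (sg' : Cin' → Sg)
    (hW' : ∀ c u v, (W' c).Adj u v → (u ∈ S ∨ u = m) ∧ (v ∈ S ∨ v = m))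
    (hP' : ∀ c, w' c ≠ 0 → ∀ s ∈ S, ∀ s' ∈ S, ((W' c).Reachable s s' ↔ P (sg' c) s s'))
    (κ κ' : ℝ)
    (hT : ∀ σ, κ * ∑ c, (if sg c = σ then w c else 0) = κ' * ∑ c, (if sg' c = σ then w' c else 0))
    (Δ : Set (B × B)) :
    κ * ∑ c, (if {pq : B × B | (W c ⊔ R).Reachable (emb pq.1) (emb pq.2)} = Δ then w c else 0) =
    κ' * ∑ c, (if {pq : B × B | (W' c ⊔ R).Reachable (emb pq.1) (emb pq.2)} = Δ then w' c else 0) := by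
  classical
  let T : Finset Sg := Finset.image sg Finset.univ ∪ Finset.image sg' Finset.univ
  simp_rw [summand_eq_of_sig S m R hR emb hemb P W w sg hW hP Δ,
    summand_eq_of_sig S m R hR emb hemb P W' w' sg' hW' hP' Δ]
  rw [regroup_sum T (fun σ => if Fdiag S R emb P σ = Δ then (1 : ℝ) else 0) w sg fun c =>
      Finset.mem_union_left _ (Finset.mem_image_of_mem _ (Finset.mem_univ _)),
    regroup_sum T (fun σ => if Fdiag S R emb P σ = Δ then (1 : ℝ) else 0) w' sg' fun c =>
      Finset.mem_union_right _ (Finset.mem_image_of_mem _ (Finset.mem_univ _)),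
    Finset.mul_sum, Finset.mul_sum]
  refine Finset.sum_congr rfl fun σ _ => ?_
  rw [mul_left_comm, hT σ, mul_left_comm]

/-- Reachability is transported along an injection of the vertex set (edges mapped forward). [folklore] -/
theorem reach_map_iff {α : Type*} (f : α → V) (hf : Function.Injective f) (E : α → α → Prop)
    (a b : α) :
    (fromRel fun x y => ∃ a' b', x = f a' ∧ y = f b' ∧ E a' b').Reachable (f a) (f b) ↔
      (fromRel E).Reachable a b := by
  constructor
  · rintro ⟨p⟩
    suffices key : ∀ x y (q : (fromRel fun x y => ∃ a' b', x = f a' ∧ y = f b' ∧ E a' b').Walk x y)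
        (a : α), x = f a → ∀ b, y = f b → (fromRel E).Reachable a b from key _ _ p a rfl b rfl
    intro x y q
    induction q with
    | nil => intro a ha b hb; rw [hf (ha.symm.trans hb)]
    | @cons u v w huv q ih =>
      intro a ha b hb
      subst ha
      rcases huv with ⟨hne, ⟨a', b', ha', rfl, h⟩ | ⟨a', b', rfl, hb', h⟩⟩
      · obtain rfl := hf ha'
        exact (Adj.reachable (show (fromRel E).Adj a b' from ⟨fun h' => hne (h' ▸ rfl), Or.inl h⟩)).trans
          (ih b' rfl b hb)
      · have hab : a = b' := hf hb'
        subst hab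
        exact (Adj.reachable (show (fromRel E).Adj a a' from ⟨fun h' => hne (h' ▸ rfl), Or.inr h⟩)).trans
          (ih a' rfl b hb)
  · intro h
    let φ : (fromRel E) →g (fromRel fun x y => ∃ a' b', x = f a' ∧ y = f b' ∧ E a' b') :=
      { toFun := f
        map_rel' := fun {a b} hab => by
          rcases hab with ⟨hne, h | h⟩
          · exact ⟨fun h' => hne (hf h'), Or.inl ⟨a, b, rfl, rfl, h⟩⟩
          · exact ⟨fun h' => hne (hf h'), Or.inr ⟨b, a, rfl, rfl, h⟩⟩ }
    exact h.map φ

end Graph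

/-! ## §4 Necklaces: the block opened up along the middle column, with arbitrary pieces -/

section Necklace

variable {L : ℕ}

/-- Vertices of a necklace: block cells (columns `0`, `2` used) and the `L+2` levels. [folklore] -/
abbrev Vx (L : ℕ) : Type := (Fin 3 × ZMod L) ⊕ Fin (L + 2)

/-- Piece descriptor: kind and row. [folklore] -/
structure PD (L : ℕ) where
  kind : Kind
  row : ZMod L

/-- A necklace: one piece per position `i`, sitting between the levels `i` and `i+1`. [folklore] -/
abbrev Neck (L : ℕ) : Type := Fin (L + 2) → PD L

/-- A configuration: level colours and position bits. [folklore] -/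
abbrev Cfg (L : ℕ) : Type := (Fin (L + 2) → Bool) × (Fin (L + 2) → Bool × Bool)

/-- Membership in a conditional edge. [folklore] -/
theorem mem_ce {W : Type*} (p : Bool) (u v : W) (e : W × W) : e ∈ ce p u v ↔ p = true ∧ e = (u, v) := by
  unfold ce; split <;> simp_all

/-- Naturality of the piece edges in the vertex type. [folklore] -/
theorem pieceE_map {W W' : Type*} (f : W → W') (k : Kind) (ca cb cc cd clo chi : Bool)
    (bits : Bool × Bool) (a b c d vl vh : W) :
    (pieceE k ca cb cc cd clo chi bits a b c d vl vh).map (Prod.map f f) =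
      pieceE k ca cb cc cd clo chi bits (f a) (f b) (f c) (f d) (f vl) (f vh) := by
  have hce : ∀ (p : Bool) (u v : W), (ce p u v).map (Prod.map f f) = ce p (f u) (f v) := by
    intro p u v; unfold ce; split <;> rfl
  cases k <;> simp only [pieceE, rhE, List.map_append, hce]

/-- Every piece edge joins two of the six local vertices. [folklore] -/
theorem pieceE_verts {W : Type*} (k : Kind) (ca cb cc cd clo chi : Bool) (bits : Bool × Bool)
    (a b c d vl vh : W) (e : W × W) (he : e ∈ pieceE k ca cb cc cd clo chi bits a b c d vl vh) :
    (e.1 = a ∨ e.1 = b ∨ e.1 = c ∨ e.1 = d ∨ e.1 = vl ∨ e.1 = vh) ∧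
    (e.2 = a ∨ e.2 = b ∨ e.2 = c ∨ e.2 = d ∨ e.2 = vl ∨ e.2 = vh) := by
  cases k <;> simp only [pieceE, rhE, List.mem_append, mem_ce] at he <;> aesop

/-- Edges of the piece `p` placed between the level vertices `vl`, `vh`. [folklore] -/
def pEdges (ξ ζ : ZMod L → Bool) (p : PD L) (clo chi : Bool) (bits : Bool × Bool) (vl vh : Vx L) :
    List (Vx L × Vx L) :=
  pieceE p.kind (ξ p.row) (ζ p.row) (ξ (p.row + 1)) (ζ (p.row + 1)) clo chi bits
    (Sum.inl (0, p.row)) (Sum.inl (2, p.row)) (Sum.inl (0, p.row + 1)) (Sum.inl (2, p.row + 1)) vl vh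

/-- Weight of the piece `p`. [folklore] -/
def pW (ξ ζ : ZMod L → Bool) (p : PD L) (clo chi : Bool) (bits : Bool × Bool) : ℤ√3 :=
  pieceW p.kind (ξ p.row) (ζ p.row) (ξ (p.row + 1)) (ζ (p.row + 1)) clo chi bits

/-- Edge set of the pieces at the positions selected by `I`. [folklore] -/
def neckE (nk : Neck L) (ξ ζ : ZMod L → Bool) (cfg : Cfg L) (I : Fin (L + 2) → Prop) :
    Set (Vx L × Vx L) :=
  {e | ∃ i, I i ∧ e ∈ pEdges ξ ζ (nk i) (cfg.1 i) (cfg.1 (i + 1)) (cfg.2 i) (Sum.inr i) (Sum.inr (i + 1))}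

/-- The (monochromatic) graph of the selected pieces. [folklore] -/
def neckG (nk : Neck L) (ξ ζ : ZMod L → Bool) (cfg : Cfg L) (I : Fin (L + 2) → Prop) :
    SimpleGraph (Vx L) :=
  fromRel fun u v => (u, v) ∈ neckE nk ξ ζ cfg I

/-- Total weight. [folklore] -/
def neckW (nk : Neck L) (ξ ζ : ZMod L → Bool) (cfg : Cfg L) : ℤ√3 :=
  ∏ i, pW ξ ζ (nk i) (cfg.1 i) (cfg.1 (i + 1)) (cfg.2 i)

/-- Boundary cell of a side index, as in `blockDiagram`. [folklore] -/
def bcell (p : Fin 2 × ZMod L) : Fin 3 × ZMod L := ((![0, 2] : Fin 2 → Fin 3) p.1, p.2)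

/-- The boundary diagram of a graph on the necklace vertices. [folklore] -/
def diagOf (G : SimpleGraph (Vx L)) : Set ((Fin 2 × ZMod L) × (Fin 2 × ZMod L)) :=
  {pq | G.Reachable (Sum.inl (bcell pq.1)) (Sum.inl (bcell pq.2))}

/-- `ℤ√3 → ℝ`. [folklore] -/
noncomputable def toR : ℤ√3 →+* ℝ := Zsqrtd.toReal (d := 3) (by norm_num)

open scoped Classical in
/-- Diagram-resolved necklace weight. [folklore] -/
noncomputable def pinnedN (nk : Neck L) (ξ ζ : ZMod L → Bool)
    (Δ : Set ((Fin 2 × ZMod L) × (Fin 2 × ZMod L))) : ℝ :=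
  ∑ cfg : Cfg L, if diagOf (neckG nk ξ ζ cfg fun _ => True) = Δ then toR (neckW nk ξ ζ cfg) else 0

/-! ### Window coordinates -/

/-- Overwrite the in-window data at position `j` (colour of level `j+1`, bits of `j`, `j+1`). [folklore] -/
def ins (j : Fin (L + 2)) (o : Cfg L) (x : WinIn) : Cfg L :=
  (fun i => if i = j + 1 then x.1 else o.1 i,
   fun i => if i = j then x.2.1 else if i = j + 1 then x.2.2 else o.2 i)

/-- Read the in-window data. [folklore] -/
def ext (j : Fin (L + 2)) (cfg : Cfg L) : WinIn := (cfg.1 (j + 1), cfg.2 j, cfg.2 (j + 1))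

/-- Default in-window data. [folklore] -/
def x0 : WinIn := (false, (false, false), (false, false))

/-- `j + 1 ≠ j` in `Fin (L+2)`. [folklore] -/
theorem succ_ne (j : Fin (L + 2)) : j + 1 ≠ j := by
  intro h
  have h1 := congrArg Fin.val (add_eq_left.mp h)
  simp at h1

/-- Overwriting a configuration with its own window data does nothing. [folklore] -/
theorem ins_ext (j : Fin (L + 2)) (cfg : Cfg L) : ins j cfg (ext j cfg) = cfg := by
  ext i <;> simp only [ins, ext] <;> split_ifs <;> subst_vars <;> rfl

/-- Reading back overwritten window data. [folklore] -/
theorem ext_ins (j : Fin (L + 2)) (o : Cfg L) (x : WinIn) : ext j (ins j o x) = x := by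
  simp [ins, ext]

/-- Overwriting twice. [folklore] -/
theorem ins_ins (j : Fin (L + 2)) (o : Cfg L) (x y : WinIn) : ins j (ins j o x) y = ins j o y := by
  ext i <;> simp only [ins] <;> split_ifs <;> rfl

/-- Overwriting does not touch colours off level `j+1`. [folklore] -/
theorem ins_fst_of_ne {j i : Fin (L + 2)} (o : Cfg L) (x : WinIn) (h : i ≠ j + 1) :
    (ins j o x).1 i = o.1 i := by simp [ins, h]

/-- Overwriting does not touch bits off positions `j`, `j+1`. [folklore] -/
theorem ins_snd_of_ne {j i : Fin (L + 2)} (o : Cfg L) (x : WinIn) (h : i ≠ j) (h' : i ≠ j + 1) :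
    (ins j o x).2 i = o.2 i := by simp [ins, h, h']

/-- Summing over configurations = summing over the off-window part and the in-window data. [folklore] -/
theorem sum_split (j : Fin (L + 2)) (F : Cfg L → ℝ) :
    ∑ cfg, F cfg = ∑ o ∈ Finset.univ.filter (fun o => ins j o x0 = o), ∑ x : WinIn, F (ins j o x) := by
  classical
  rw [← Finset.sum_product' (Finset.univ.filter (fun o => ins j o x0 = o)) Finset.univ
    (fun o x => F (ins j o x))]
  refine Finset.sum_nbij' (fun cfg => (ins j cfg x0, ext j cfg)) (fun p => ins j p.1 p.2) ?_ ?_ ?_ ?_ ?_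
  · intro cfg _; simp [ins_ins]
  · intro p _; simp
  · intro cfg _; simp [ins_ins, ins_ext]
  · rintro ⟨o, x⟩ hp
    simp only [Finset.mem_product, Finset.mem_filter, Finset.mem_univ, true_and, and_true] at hp
    simp [ins_ins, ext_ins, hp]
  · intro cfg _; simp [ins_ins, ins_ext]

/-- Splitting the necklace graph into the pieces selected by `I` and the others. [folklore] -/
theorem neckG_split (nk : Neck L) (ξ ζ : ZMod L → Bool) (cfg : Cfg L) (I : Fin (L + 2) → Prop) :
    neckG nk ξ ζ cfg (fun _ => True) = neckG nk ξ ζ cfg I ⊔ neckG nk ξ ζ cfg (fun i => ¬ I i) := by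
  ext u v
  simp only [neckG, neckE, Set.mem_setOf_eq, fromRel_adj, sup_adj, true_and]
  constructor
  · rintro ⟨hne, ⟨i, h⟩ | ⟨i, h⟩⟩ <;> by_cases hi : I i
    · exact Or.inl ⟨hne, Or.inl ⟨i, hi, h⟩⟩
    · exact Or.inr ⟨hne, Or.inl ⟨i, hi, h⟩⟩
    · exact Or.inl ⟨hne, Or.inr ⟨i, hi, h⟩⟩
    · exact Or.inr ⟨hne, Or.inr ⟨i, hi, h⟩⟩
  · rintro (⟨hne, ⟨i, -, h⟩ | ⟨i, -, h⟩⟩ | ⟨hne, ⟨i, -, h⟩ | ⟨i, -, h⟩⟩)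
    · exact ⟨hne, Or.inl ⟨i, h⟩⟩
    · exact ⟨hne, Or.inr ⟨i, h⟩⟩
    · exact ⟨hne, Or.inl ⟨i, h⟩⟩
    · exact ⟨hne, Or.inr ⟨i, h⟩⟩

/-- The off-window pieces do not see the in-window data. [folklore] -/
theorem neckG_rest_ins (nk : Neck L) (ξ ζ : ZMod L → Bool) (j : Fin (L + 2)) (o : Cfg L) (x : WinIn) :
    neckG nk ξ ζ (ins j o x) (fun i => ¬ (i = j ∨ i = j + 1)) =
      neckG nk ξ ζ o (fun i => ¬ (i = j ∨ i = j + 1)) := by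
  have key : ∀ i, ¬ (i = j ∨ i = j + 1) →
      ((ins j o x).1 i = o.1 i ∧ (ins j o x).1 (i + 1) = o.1 (i + 1) ∧ (ins j o x).2 i = o.2 i) := by
    intro i hi
    push_cast [not_or] at hi
    exact ⟨ins_fst_of_ne o x hi.2, ins_fst_of_ne o x fun h => hi.1 (add_right_cancel h),
      ins_snd_of_ne o x hi.1 hi.2⟩
  ext u v
  simp only [neckG, neckE, Set.mem_setOf_eq, fromRel_adj]
  constructor
  · rintro ⟨hne, ⟨i, hi, h⟩ | ⟨i, hi, h⟩⟩
    · obtain ⟨h1, h2, h3⟩ := key i hi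
      exact ⟨hne, Or.inl ⟨i, hi, by rwa [h1, h2, h3] at h⟩⟩
    · obtain ⟨h1, h2, h3⟩ := key i hi
      exact ⟨hne, Or.inr ⟨i, hi, by rwa [h1, h2, h3] at h⟩⟩
  · rintro ⟨hne, ⟨i, hi, h⟩ | ⟨i, hi, h⟩⟩
    · obtain ⟨h1, h2, h3⟩ := key i hi
      exact ⟨hne, Or.inl ⟨i, hi, by rwa [h1, h2, h3]⟩⟩
    · obtain ⟨h1, h2, h3⟩ := key i hi
      exact ⟨hne, Or.inr ⟨i, hi, by rwa [h1, h2, h3]⟩⟩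

/-- The off-window weight. [folklore] -/
def wRest (nk : Neck L) (ξ ζ : ZMod L → Bool) (j : Fin (L + 2)) (o : Cfg L) : ℤ√3 :=
  ∏ i ∈ ({j, j + 1} : Finset (Fin (L + 2)))ᶜ, pW ξ ζ (nk i) (o.1 i) (o.1 (i + 1)) (o.2 i)

/-- Weight factorisation: window part times the rest. [folklore] -/
theorem neckW_ins (nk : Neck L) (ξ ζ : ZMod L → Bool) (j : Fin (L + 2)) (o : Cfg L) (x : WinIn) :
    neckW nk ξ ζ (ins j o x) =
      (pW ξ ζ (nk j) (o.1 j) x.1 x.2.1 * pW ξ ζ (nk (j + 1)) x.1 (o.1 (j + 1 + 1)) x.2.2) *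
        wRest nk ξ ζ j o := by
  classical
  rw [neckW, ← Finset.prod_mul_prod_compl ({j, j + 1} : Finset (Fin (L + 2))),
    Finset.prod_pair (succ_ne j).symm, wRest]
  have hj2 : j + 1 + 1 ≠ j + 1 := succ_ne (j + 1)
  congr 1
  · simp [ins, (succ_ne j).symm, hj2]
  · refine Finset.prod_congr rfl fun i hi => ?_
    simp only [Finset.mem_compl, Finset.mem_insert, Finset.mem_singleton] at hi
    push_cast [not_or] at hi
    rw [ins_fst_of_ne o x hi.2, ins_fst_of_ne o x fun h => hi.1 (add_right_cancel h),
      ins_snd_of_ne o x hi.1 hi.2]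

end Necklace

end DX

/-- REGISTERED SUB-GOAL of part 2: the separator lemma. [folklore] -/
theorem diagramExchange_separator : ∀ {V : Type*} (W R : SimpleGraph V) (S : Set V) (m : V), (∀ u v, W.Adj u v → (u ∈ S ∨ u = m) ∧ (v ∈ S ∨ v = m)) → (∀ v, ¬ R.Adj m v) → ∀ {x y : V}, x ≠ m → y ≠ m → ((W ⊔ R).Reachable x y ↔ (DX.linkG W S ⊔ R).Reachable x y) :=
  DX.sep_core

end Summit.CriticalPhenomena.CardyFormulaZ2.Theorems.IKLinearTransport.PinnedDiagramExchange
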